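import Literature.Analysis.FluidPDE.PerturbedEnergySlice
import Literature.Analysis.FluidPDE.MildSolutionProofs
import Literature.Analysis.FluidPDE.PerturbationProductEstimate
import Literature.Analysis.FluidPDE.SerrinEnstrophyGronwall
import Literature.Analysis.FluidPDE.KatoUniqueness
import Literature.Analysis.FluidPDE.SuitableWeakRightContinuity
import HarnessLib

/-!
# The perturbed energy inequality on the whole space

Analysis/FluidPDE theorem file (no definitions, no named facts). From the sliced local inequality
`ae_perturbed_energy_slice_of_data` (Jia–Šverák 2014 / Lemarié-Rieusset 2016, Prop. 14.1,
Thm. 14.7, (14.31)) tested against the expanding cut-offs `χ_R`, `R → ∞`, we derive the **global**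
energy inequality for the difference `w = u - a` of a local Leray solution `(u, p)` with finite
energy and a bounded regular flow `(a, p_K)` with finite energy:

  `‖w(s)‖₂² + 2 ∫₀ˢ ‖∇w‖₂² ≤ ‖u₀ - a₀‖₂² - 2 ∫₀ˢ ∫ ⟪Da(w), w⟫`   for a.e. `s`,

the flux terms `∫∫ |w|²Δχ_R`, `∫∫ |w|² u·∇χ_R`, `∫∫ (p - p_K) w·∇χ_R` vanishing in the limit because
`w ∈ L² ∩ L³`, `u ∈ L³` and `p, p_K ∈ L^{3/2}` on the strip (Lemarié-Rieusset 2016, p. 525, the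
energy estimate for `∂ₜw - Δw + div(w⊗w + α₁⊗w + w⊗α₁) + ∇q = 0`; Seregin 2014, App. B, §B.5,
(B.5.4)–(B.5.5)). This is the starting point of the Gronwall argument in the extension step of the
local energy theory (`localEnergySolution_extension_of_memE2`).

## References

* P. G. Lemarié-Rieusset, *The Navier–Stokes Problem in the 21st Century* (2016), Thm. 14.8,
  proof, Step 2 (PDF p. 525).
* G. Seregin, *Lecture Notes on Regularity Theory for the Navier–Stokes Equations* (2014), App. B,
  §B.5.
* H. Jia, V. Šverák, Invent. Math. 196 (2014), §3.
-/

noncomputable section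

open MeasureTheory TopologicalSpace Set Function Filter Metric
open _root_.Topology
open scoped ENNReal NNReal RealInnerProductSpace Laplacian

namespace Literature.Analysis.FluidPDE

open JiaSverak2014

/-- The support of the tree's cut-off `χ_R` lies in the ball `B(0, 2R + 1)`. [folklore] -/
theorem tsupport_cutoff_subset_ball {R : ℝ} (hR : 0 < R) :
    tsupport (cutoff (E := EuclideanSpace ℝ (Fin 3)) R) ⊆ ball 0 (2 * R + 1) := by
  have h1 : tsupport (cutoff (E := EuclideanSpace ℝ (Fin 3)) R) ⊆ closedBall (0 : EuclideanSpace ℝ (Fin 3)) (2 * R) := by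
    refine closure_minimal (fun x hx => ?_) isClosed_closedBall
    rw [mem_closedBall_zero_iff]
    by_contra h
    exact hx (cutoff_eq_zero hR (not_le.1 h).le)
  exact h1.trans (closedBall_subset_ball (by linarith))

set_option maxHeartbeats 3200000 in
/-- **The perturbed energy inequality on the whole space** (Lemarié-Rieusset 2016, Thm. 14.8,
proof, Step 2, p. 525; Seregin 2014, App. B, (B.5.4)). In the setting of
`ae_perturbed_energy_slice_of_data` — a local Leray solution `(u, p)` on `(0,T') × ℝ³` with datum
`u₀ ∈ L²`, a regular flow `(a, p_K, π)` from `a₀ ∈ L²` — assume moreover the global bounds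
`∫ |u(t)|² ≤ E_u` (a.e. `t`), `∫ |a(t)|² ≤ E_a`, `u ∈ L³((0,T') × ℝ³)`, `p ∈ L^{3/2}((0,T') × ℝ³)`,
`p_K ∈ L^{3/2}((0,S₀) × ℝ³)`. Then for a.e. `s ∈ (0, min(T', S₀))`, with `w = u - a`,
`‖w(s)‖₂² + 2 ∫∫_{(0,s)×ℝ³} |G - Da|² ≤ ‖u₀ - a₀‖₂² - 2 ∫∫_{(0,s)×ℝ³} ⟪Da(w), w⟫` (in `ℝ≥0∞`).
[cite: LemarieRieusset2016, Thm. 14.8 proof Step 2 (PDF p. 525)] [cite: Seregin2014Notes, App. B §B.5 (B.5.4)] -/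
theorem ae_perturbed_energy_wholeSpace {T' S₀ S₂ A C₁ : ℝ}
    {u₀ a₀ : (EuclideanSpace ℝ (Fin 3)) → (EuclideanSpace ℝ (Fin 3))}
    {u a : ℝ → (EuclideanSpace ℝ (Fin 3)) → (EuclideanSpace ℝ (Fin 3))}
    {p π pK : ℝ → (EuclideanSpace ℝ (Fin 3)) → ℝ}
    {G : ℝ → (EuclideanSpace ℝ (Fin 3)) → (EuclideanSpace ℝ (Fin 3)) →L[ℝ] (EuclideanSpace ℝ (Fin 3))}
    (hT' : 0 < T') (hm₀ : AEStronglyMeasurable u₀ volume)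
    (hu : IsLocalLeraySolutionOn T' 1 u₀ u p)
    (hG : HasWeakSpatialGradientOn (slab (EuclideanSpace ℝ (Fin 3)) (Ioo 0 T') isOpen_Ioo) u G)
    (hGb : ∀ R : ℝ, 0 < R → ∃ C : ℝ≥0, ∀ y : (EuclideanSpace ℝ (Fin 3)),
      ∫⁻ z in Ioo 0 T' ×ˢ ball y R, ENNReal.ofReal (frobeniusNormSq (G z.1 z.2)) ≤ C)
    (hS₀ : 0 < S₀) (hS₀₂ : S₀ ≤ S₂) (hA : 0 < A) (hC₁ : 0 ≤ C₁)
    (hLK : IsLocalLeraySolutionOn S₀ 1 a₀ a pK)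
    (hcl : IsClassicalNSSolutionOn (Ioo 0 S₂) 1 0 a π)
    (hbd : ∀ t ∈ Ioo 0 S₂, ∀ x, ‖a t x‖ ≤ 2 * A)
    (hgrad : ∀ t ∈ Ioo 0 S₀, ∀ x, Real.sqrt t * ‖fderiv ℝ (a t) x‖ ≤ C₁ * A)
    (ha₀m : AEStronglyMeasurable a₀ volume) (hu₀2 : MemLp u₀ 2 volume) (ha₀2 : MemLp a₀ 2 volume)
    {Eu Ea : ℝ≥0∞} (hEu : Eu ≠ ⊤) (hEa : Ea ≠ ⊤)
    (hu2 : ∀ᵐ t ∂(volume.restrict (Ioo 0 T')), ∫⁻ x, ‖u t x‖ₑ ^ 2 ≤ Eu)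
    (ha2 : ∀ t ∈ Ioo 0 S₂, ∫⁻ x, ‖a t x‖ₑ ^ 2 ≤ Ea)
    (hu3 : ∫⁻ z in Ioo 0 T' ×ˢ (univ : Set (EuclideanSpace ℝ (Fin 3))), ‖u z.1 z.2‖ₑ ^ (3 : ℕ) < ⊤)
    (hp32 : ∫⁻ z in Ioo 0 T' ×ˢ (univ : Set (EuclideanSpace ℝ (Fin 3))), ‖p z.1 z.2‖ₑ ^ (3 / 2 : ℝ) < ⊤)
    (hpK32 : ∫⁻ z in Ioo 0 S₀ ×ˢ (univ : Set (EuclideanSpace ℝ (Fin 3))), ‖pK z.1 z.2‖ₑ ^ (3 / 2 : ℝ) < ⊤) :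
    ∀ᵐ s ∂(volume.restrict (Ioo 0 (min T' S₀))),
      ENNReal.ofReal (∫ x, ‖u s x - a s x‖ ^ 2) +
          2 * ∫⁻ z in Ioo 0 s ×ˢ (univ : Set (EuclideanSpace ℝ (Fin 3))),
            ENNReal.ofReal (frobeniusNormSq (G z.1 z.2 - fderiv ℝ (a z.1) z.2)) ≤
        ENNReal.ofReal (∫ x, ‖u₀ x - a₀ x‖ ^ 2) +
        ENNReal.ofReal (-2 * ∫ z in Ioo 0 s ×ˢ (univ : Set (EuclideanSpace ℝ (Fin 3))),
            ⟪fderiv ℝ (a z.1) z.2 (u z.1 z.2 - a z.1 z.2), u z.1 z.2 - a z.1 z.2⟫) := by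
  set S : ℝ := min T' S₀ with hSdef
  have hS : 0 < S := lt_min hT' hS₀
  have hST' : S ≤ T' := min_le_left _ _
  have hSS₀ : S ≤ S₀ := min_le_right _ _
  have hSS₂ : S ≤ S₂ := hSS₀.trans hS₀₂
  -- ## the cut-offs `ψ_n = χ_{n+1}`
  obtain ⟨Cg, hCg0, hCg⟩ := exists_norm_fderiv_cutoff_le (E := EuclideanSpace ℝ (Fin 3))
  obtain ⟨CL, hCL0, hCL⟩ := exists_abs_laplacian_cutoff_le (E := EuclideanSpace ℝ (Fin 3))
  set ψ : ℕ → (EuclideanSpace ℝ (Fin 3)) → ℝ := fun n => cutoff ((n : ℝ) + 1) with hψdef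
  have hn1 : ∀ n : ℕ, (0 : ℝ) < (n : ℝ) + 1 := fun n => by positivity
  have hψcd : ∀ n, ContDiff ℝ (⊤ : ℕ∞) (ψ n) := fun n => contDiff_cutoff _
  have hψ0 : ∀ n x, 0 ≤ ψ n x := fun n x => cutoff_nonneg _ _
  have hψ1 : ∀ n x, ψ n x ≤ 1 := fun n x => cutoff_le_one _ _
  have hψabs : ∀ n x, |ψ n x| ≤ 1 := fun n x => abs_cutoff_le_one _ _
  have hψsupp : ∀ n, tsupport (ψ n) ⊆ ball (0 : EuclideanSpace ℝ (Fin 3)) (2 * ((n : ℝ) + 1) + 1) :=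
    fun n => tsupport_cutoff_subset_ball (hn1 n)
  have hψone : ∀ (n : ℕ) (x : EuclideanSpace ℝ (Fin 3)), ‖x‖ ≤ (n : ℝ) + 1 → ψ n x = 1 :=
    fun n x hx => cutoff_eq_one (hn1 n) hx
  have hgradψ : ∀ (n : ℕ) x, ‖gradient (ψ n) x‖ ≤ Cg / ((n : ℝ) + 1) := fun n x => by
    have e : ‖gradient (ψ n) x‖ = ‖fderiv ℝ (ψ n) x‖ := by
      rw [gradient, LinearIsometryEquiv.norm_map]
    rw [e]; exact hCg _ (hn1 n) x
  have hLapψ : ∀ (n : ℕ) x, |(Δ (ψ n)) x| ≤ CL / ((n : ℝ) + 1) ^ 2 := fun n x => hCL _ (hn1 n) x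
  have hψlim : ∀ x, Tendsto (fun n => ψ n x) atTop (𝓝 1) := fun x => tendsto_cutoff_natCast_add_one x
  have hgcont : ∀ n, Continuous fun x => gradient (ψ n) x := fun n =>
    (InnerProductSpace.toDual ℝ (EuclideanSpace ℝ (Fin 3))).symm.continuous.comp ((hψcd n).continuous_fderiv (by simp))
  have hLcont : ∀ n, Continuous fun x => (Δ (ψ n)) x := fun n => continuous_laplacian ((hψcd n).of_le (by norm_cast))
  -- ## the sliced inequalities for all `n`, a.e. in `s`
  have hineq : ∀ᵐ s ∂(volume.restrict (Ioo 0 S)), ∀ n : ℕ,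
      ENNReal.ofReal (∫ x, ‖u s x - a s x‖ ^ 2 * ψ n x) +
          2 * ∫⁻ z in Ioo 0 s ×ˢ (univ : Set (EuclideanSpace ℝ (Fin 3))),
            ENNReal.ofReal (frobeniusNormSq (G z.1 z.2 - fderiv ℝ (a z.1) z.2) * ψ n z.2) ≤
        ENNReal.ofReal (∫ x, ‖u₀ x - a₀ x‖ ^ 2 * ψ n x) +
        ENNReal.ofReal (∫ z in Ioo 0 s ×ˢ (univ : Set (EuclideanSpace ℝ (Fin 3))),
          (‖u z.1 z.2 - a z.1 z.2‖ ^ 2 * (Δ (ψ n)) z.2 +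
            ‖u z.1 z.2 - a z.1 z.2‖ ^ 2 * ⟪u z.1 z.2, gradient (ψ n) z.2⟫ +
            2 * ((p z.1 z.2 - pK z.1 z.2) * ⟪u z.1 z.2 - a z.1 z.2, gradient (ψ n) z.2⟫) -
            2 * (ψ n z.2 * ⟪fderiv ℝ (a z.1) z.2 (u z.1 z.2 - a z.1 z.2), u z.1 z.2 - a z.1 z.2⟫))) := by
    rw [ae_all_iff]
    intro n
    exact ae_perturbed_energy_slice_of_data hT' hm₀ hu hG hGb hS₀ hS₀₂ hA hC₁ hLK hcl hbd hgrad
      (by positivity : (0 : ℝ) < 2 * ((n : ℝ) + 1) + 1) ha₀m hu₀2 ha₀2 (hψcd n) (hψsupp n) (hψ0 n)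
  -- ## measurability on the strip `(0,S) × ℝ³`
  set I : Set ℝ := Ioo 0 S with hI
  have hIm : MeasurableSet (I ×ˢ (univ : Set (EuclideanSpace ℝ (Fin 3)))) := measurableSet_Ioo.prod MeasurableSet.univ
  have hIT' : I ⊆ Ioo 0 T' := Ioo_subset_Ioo_right hST'
  have hIS₀ : I ⊆ Ioo 0 S₀ := Ioo_subset_Ioo_right hSS₀
  have hIS₂ : I ⊆ Ioo 0 S₂ := Ioo_subset_Ioo_right hSS₂
  set μI : Measure (ℝ × EuclideanSpace ℝ (Fin 3)) := volume.restrict (I ×ˢ (univ : Set (EuclideanSpace ℝ (Fin 3)))) with hμI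
  have hμIprod : μI = (volume.restrict I).prod (volume : Measure (EuclideanSpace ℝ (Fin 3))) := by
    rw [hμI, hI, volume_restrict_slab_eq_prod]
  have hmemI : ∀ᵐ z ∂μI, z ∈ I ×ˢ (univ : Set (EuclideanSpace ℝ (Fin 3))) := ae_restrict_mem hIm
  have hum : AEStronglyMeasurable (uncurry u) μI :=
    hu.aestronglyMeasurable.mono_measure (Measure.restrict_mono (Set.prod_mono hIT' Subset.rfl) le_rfl)
  have hacont : ContinuousOn (uncurry a) (Ioo 0 S₂ ×ˢ (univ : Set (EuclideanSpace ℝ (Fin 3)))) :=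
    hcl.smooth_velocity.continuousOn
  have ham : AEStronglyMeasurable (uncurry a) μI :=
    (hacont.mono (Set.prod_mono hIS₂ Subset.rfl)).aestronglyMeasurable hIm
  have hDacont : ContinuousOn (fun z : ℝ × (EuclideanSpace ℝ (Fin 3)) => fderiv ℝ (a z.1) z.2)
      (Ioo 0 S₂ ×ˢ (univ : Set (EuclideanSpace ℝ (Fin 3)))) :=
    (hcl.smooth_velocity.fderiv_slice isOpen_Ioo.uniqueDiffOn).continuousOn
  have hDam : AEStronglyMeasurable (fun z : ℝ × (EuclideanSpace ℝ (Fin 3)) => fderiv ℝ (a z.1) z.2) μI :=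
    (hDacont.mono (Set.prod_mono hIS₂ Subset.rfl)).aestronglyMeasurable hIm
  have hpm : AEStronglyMeasurable (uncurry p) μI :=
    hu.aestronglyMeasurable_pressure.mono_measure (Measure.restrict_mono (Set.prod_mono hIT' Subset.rfl) le_rfl)
  have hpKm : AEStronglyMeasurable (uncurry pK) μI :=
    hLK.aestronglyMeasurable_pressure.mono_measure (Measure.restrict_mono (Set.prod_mono hIS₀ Subset.rfl) le_rfl)
  have hwm : AEStronglyMeasurable (fun z : ℝ × EuclideanSpace ℝ (Fin 3) => u z.1 z.2 - a z.1 z.2) μI := hum.sub ham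
  have hu2m : AEMeasurable (fun z : ℝ × EuclideanSpace ℝ (Fin 3) => ‖u z.1 z.2‖ₑ ^ 2) μI := hum.enorm.pow_const _
  have hu3m : AEMeasurable (fun z : ℝ × EuclideanSpace ℝ (Fin 3) => ‖u z.1 z.2‖ₑ ^ (3 : ℕ)) μI := hum.enorm.pow_const _
  have hp32m : AEMeasurable (fun z : ℝ × EuclideanSpace ℝ (Fin 3) => ‖p z.1 z.2‖ₑ ^ (3 / 2 : ℝ)) μI :=
    hpm.enorm.pow_const _
  -- ## global integrability on the strip
  -- `∫∫ |u|² ≤ E_u |I|`, `∫∫ |a|² ≤ E_a |I|`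
  have hvolI : volume I < ⊤ := by rw [hI]; exact measure_Ioo_lt_top
  -- Tonelli on the strip
  have htonelli : ∀ F : ℝ × EuclideanSpace ℝ (Fin 3) → ℝ≥0∞, AEMeasurable F μI →
      ∫⁻ z, F z ∂μI = ∫⁻ t in I, ∫⁻ x, F (t, x) := by
    intro F hF
    have hF' : AEMeasurable F ((volume.restrict I).prod (volume : Measure (EuclideanSpace ℝ (Fin 3)))) := by
      rw [← hμIprod]; exact hF
    rw [hμIprod, lintegral_prod _ hF']
  have hu2I : ∫⁻ z, ‖u z.1 z.2‖ₑ ^ 2 ∂μI ≤ Eu * volume I := by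
    rw [htonelli (fun z => ‖u z.1 z.2‖ₑ ^ 2) (hum.enorm.pow_const _)]
    calc ∫⁻ t in I, ∫⁻ x, ‖u t x‖ₑ ^ 2 ≤ ∫⁻ _ in I, Eu :=
          lintegral_mono_ae (ae_restrict_of_ae_restrict_of_subset hIT' hu2)
      _ = Eu * volume I := by rw [setLIntegral_const]
  have ha2I : ∫⁻ z, ‖a z.1 z.2‖ₑ ^ 2 ∂μI ≤ Ea * volume I := by
    rw [htonelli (fun z => ‖a z.1 z.2‖ₑ ^ 2) (ham.enorm.pow_const _)]
    calc ∫⁻ t in I, ∫⁻ x, ‖a t x‖ₑ ^ 2 ≤ ∫⁻ _ in I, Ea := by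
          refine lintegral_mono_ae ?_
          filter_upwards [ae_restrict_mem measurableSet_Ioo] with t ht
          exact ha2 t (hIS₂ ht)
      _ = Ea * volume I := by rw [setLIntegral_const]
  have hu2It : ∫⁻ z, ‖u z.1 z.2‖ₑ ^ 2 ∂μI < ⊤ := hu2I.trans_lt (ENNReal.mul_lt_top hEu.lt_top hvolI)
  have ha2It : ∫⁻ z, ‖a z.1 z.2‖ₑ ^ 2 ∂μI < ⊤ := ha2I.trans_lt (ENNReal.mul_lt_top hEa.lt_top hvolI)
  -- `∫∫ |w|² < ∞`
  have hw2It : ∫⁻ z, ‖u z.1 z.2 - a z.1 z.2‖ₑ ^ 2 ∂μI < ⊤ := by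
    calc ∫⁻ z, ‖u z.1 z.2 - a z.1 z.2‖ₑ ^ 2 ∂μI ≤ ∫⁻ z, 2 * (‖u z.1 z.2‖ₑ ^ 2 + ‖a z.1 z.2‖ₑ ^ 2) ∂μI := by
          refine lintegral_mono fun z => ?_
          calc ‖u z.1 z.2 - a z.1 z.2‖ₑ ^ 2 ≤ (‖u z.1 z.2‖ₑ + ‖a z.1 z.2‖ₑ) ^ 2 := by gcongr; exact enorm_sub_le
            _ ≤ 2 * (‖u z.1 z.2‖ₑ ^ 2 + ‖a z.1 z.2‖ₑ ^ 2) := (ennreal_add_sq_le _ _).trans_eq (by ring)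
      _ = 2 * ((∫⁻ z, ‖u z.1 z.2‖ₑ ^ 2 ∂μI) + ∫⁻ z, ‖a z.1 z.2‖ₑ ^ 2 ∂μI) := by
          rw [lintegral_const_mul' _ _ ENNReal.ofNat_ne_top, lintegral_add_left' hu2m]
      _ < ⊤ := ENNReal.mul_lt_top ENNReal.ofNat_lt_top (ENNReal.add_lt_top.2 ⟨hu2It, ha2It⟩)
  -- `∫∫ |u|³ < ∞`, `∫∫ |a|³ < ∞`, `∫∫ |w|³ < ∞`
  have hu3I : ∫⁻ z, ‖u z.1 z.2‖ₑ ^ (3 : ℕ) ∂μI < ⊤ :=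
    (lintegral_mono_set (Set.prod_mono hIT' Subset.rfl)).trans_lt hu3
  have ha3I : ∫⁻ z, ‖a z.1 z.2‖ₑ ^ (3 : ℕ) ∂μI < ⊤ := by
    calc ∫⁻ z, ‖a z.1 z.2‖ₑ ^ (3 : ℕ) ∂μI ≤ ∫⁻ z, ENNReal.ofReal (2 * A) * ‖a z.1 z.2‖ₑ ^ 2 ∂μI := by
          refine lintegral_mono_ae ?_
          filter_upwards [hmemI] with z hz
          have hb : ‖a z.1 z.2‖ₑ ≤ ENNReal.ofReal (2 * A) := by
            rw [← ofReal_norm]; exact ENNReal.ofReal_le_ofReal (hbd z.1 (hIS₂ hz.1) z.2)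
          calc ‖a z.1 z.2‖ₑ ^ (3 : ℕ) = ‖a z.1 z.2‖ₑ * ‖a z.1 z.2‖ₑ ^ 2 := by ring
            _ ≤ ENNReal.ofReal (2 * A) * ‖a z.1 z.2‖ₑ ^ 2 := mul_le_mul' hb le_rfl
      _ = ENNReal.ofReal (2 * A) * ∫⁻ z, ‖a z.1 z.2‖ₑ ^ 2 ∂μI := lintegral_const_mul' _ _ ENNReal.ofReal_ne_top
      _ < ⊤ := ENNReal.mul_lt_top ENNReal.ofReal_lt_top ha2It
  have hw3I : ∫⁻ z, ‖u z.1 z.2 - a z.1 z.2‖ₑ ^ (3 : ℕ) ∂μI < ⊤ := by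
    calc ∫⁻ z, ‖u z.1 z.2 - a z.1 z.2‖ₑ ^ (3 : ℕ) ∂μI
        ≤ ∫⁻ z, 4 * (‖u z.1 z.2‖ₑ ^ (3 : ℕ) + ‖a z.1 z.2‖ₑ ^ (3 : ℕ)) ∂μI := by
          refine lintegral_mono fun z => ?_
          calc ‖u z.1 z.2 - a z.1 z.2‖ₑ ^ (3 : ℕ) ≤ (‖u z.1 z.2‖ₑ + ‖a z.1 z.2‖ₑ) ^ (3 : ℕ) := by
                gcongr; exact enorm_sub_le
            _ ≤ 4 * (‖u z.1 z.2‖ₑ ^ (3 : ℕ) + ‖a z.1 z.2‖ₑ ^ (3 : ℕ)) := by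
                -- `(x + y)³ ≤ 4 (x³ + y³)`
                have h := ENNReal.rpow_add_le_mul_rpow_add_rpow (‖u z.1 z.2‖ₑ) (‖a z.1 z.2‖ₑ)
                  (by norm_num : (1 : ℝ) ≤ 3)
                have e4 : (2 : ℝ≥0∞) ^ ((3 : ℝ) - 1) = 4 := by
                  rw [show (3 : ℝ) - 1 = ((2 : ℕ) : ℝ) by norm_num, ENNReal.rpow_natCast]; norm_num
                have e3 : ∀ w : ℝ≥0∞, w ^ (3 : ℝ) = w ^ (3 : ℕ) := fun w => by
                  rw [show (3 : ℝ) = ((3 : ℕ) : ℝ) by norm_num, ENNReal.rpow_natCast]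
                simpa only [e4, e3] using h
      _ = 4 * ((∫⁻ z, ‖u z.1 z.2‖ₑ ^ (3 : ℕ) ∂μI) + ∫⁻ z, ‖a z.1 z.2‖ₑ ^ (3 : ℕ) ∂μI) := by
          rw [lintegral_const_mul' _ _ ENNReal.ofNat_ne_top, lintegral_add_left' hu3m]
      _ < ⊤ := ENNReal.mul_lt_top ENNReal.ofNat_lt_top (ENNReal.add_lt_top.2 ⟨hu3I, ha3I⟩)
  -- `∫∫ |p|^{3/2}`, `∫∫ |pK|^{3/2}`, `∫∫ |p - pK|^{3/2} < ∞`
  have hp32I : ∫⁻ z, ‖p z.1 z.2‖ₑ ^ (3 / 2 : ℝ) ∂μI < ⊤ :=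
    (lintegral_mono_set (Set.prod_mono hIT' Subset.rfl)).trans_lt hp32
  have hpK32I : ∫⁻ z, ‖pK z.1 z.2‖ₑ ^ (3 / 2 : ℝ) ∂μI < ⊤ :=
    (lintegral_mono_set (Set.prod_mono hIS₀ Subset.rfl)).trans_lt hpK32
  have hppK32I : ∫⁻ z, ‖p z.1 z.2 - pK z.1 z.2‖ₑ ^ (3 / 2 : ℝ) ∂μI < ⊤ := by
    calc ∫⁻ z, ‖p z.1 z.2 - pK z.1 z.2‖ₑ ^ (3 / 2 : ℝ) ∂μI
        ≤ ∫⁻ z, 2 ^ ((3 / 2 : ℝ) - 1) * (‖p z.1 z.2‖ₑ ^ (3 / 2 : ℝ) + ‖pK z.1 z.2‖ₑ ^ (3 / 2 : ℝ)) ∂μI := by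
          refine lintegral_mono fun z => ?_
          calc ‖p z.1 z.2 - pK z.1 z.2‖ₑ ^ (3 / 2 : ℝ) ≤ (‖p z.1 z.2‖ₑ + ‖pK z.1 z.2‖ₑ) ^ (3 / 2 : ℝ) := by
                gcongr; exact enorm_sub_le
            _ ≤ _ := ENNReal.rpow_add_le_mul_rpow_add_rpow _ _ (by norm_num)
      _ = 2 ^ ((3 / 2 : ℝ) - 1) * ((∫⁻ z, ‖p z.1 z.2‖ₑ ^ (3 / 2 : ℝ) ∂μI) + ∫⁻ z, ‖pK z.1 z.2‖ₑ ^ (3 / 2 : ℝ) ∂μI) := by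
          rw [lintegral_const_mul' _ _ (ENNReal.rpow_ne_top_of_nonneg (by norm_num) ENNReal.ofNat_ne_top),
            lintegral_add_left' hp32m]
      _ < ⊤ := ENNReal.mul_lt_top (ENNReal.rpow_lt_top_of_nonneg (by norm_num) ENNReal.ofNat_ne_top)
          (ENNReal.add_lt_top.2 ⟨hp32I, hpK32I⟩)
  -- `∫∫ t^{-1/2} |w|² < ∞`
  have hrpowI : IntegrableOn (fun t : ℝ => t ^ (-(1 / 2 : ℝ))) I volume :=
    (intervalIntegral.integrableOn_Ioo_rpow_iff hS).2 (by norm_num)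
  have htw2I : ∫⁻ z, ENNReal.ofReal (z.1 ^ (-(1 / 2 : ℝ))) * ‖u z.1 z.2 - a z.1 z.2‖ₑ ^ 2 ∂μI < ⊤ := by
    have hmeas : AEMeasurable (fun z : ℝ × EuclideanSpace ℝ (Fin 3) =>
        ENNReal.ofReal (z.1 ^ (-(1 / 2 : ℝ))) * ‖u z.1 z.2 - a z.1 z.2‖ₑ ^ 2) μI :=
      ((measurable_fst.pow_const _).ennreal_ofReal.aemeasurable).mul (hwm.enorm.pow_const _)
    rw [htonelli _ hmeas]
    have hslice : ∀ᵐ t ∂(volume.restrict I), ∫⁻ x, ‖u t x - a t x‖ₑ ^ 2 ≤ 2 * (Eu + Ea) := by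
      filter_upwards [ae_restrict_of_ae_restrict_of_subset hIT' hu2, ae_restrict_mem measurableSet_Ioo,
        ae_restrict_of_ae_restrict_of_subset hIT' hu.ae_aestronglyMeasurable_slice'] with t ht htI htm
      calc ∫⁻ x, ‖u t x - a t x‖ₑ ^ 2 ≤ ∫⁻ x, 2 * (‖u t x‖ₑ ^ 2 + ‖a t x‖ₑ ^ 2) := by
            refine lintegral_mono fun x => ?_
            calc ‖u t x - a t x‖ₑ ^ 2 ≤ (‖u t x‖ₑ + ‖a t x‖ₑ) ^ 2 := by gcongr; exact enorm_sub_le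
              _ ≤ 2 * (‖u t x‖ₑ ^ 2 + ‖a t x‖ₑ ^ 2) := (ennreal_add_sq_le _ _).trans_eq (by ring)
        _ = 2 * ((∫⁻ x, ‖u t x‖ₑ ^ 2) + ∫⁻ x, ‖a t x‖ₑ ^ 2) := by
            rw [lintegral_const_mul' _ _ ENNReal.ofNat_ne_top, lintegral_add_left' (htm.enorm.pow_const _)]
        _ ≤ 2 * (Eu + Ea) := mul_le_mul' le_rfl (add_le_add ht (ha2 t (hIS₂ htI)))
    calc ∫⁻ t in I, ∫⁻ x, ENNReal.ofReal (t ^ (-(1 / 2 : ℝ))) * ‖u t x - a t x‖ₑ ^ 2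
        = ∫⁻ t in I, ENNReal.ofReal (t ^ (-(1 / 2 : ℝ))) * ∫⁻ x, ‖u t x - a t x‖ₑ ^ 2 := by
          refine lintegral_congr_ae ?_
          filter_upwards [ae_restrict_of_ae_restrict_of_subset hIT' hu.ae_aestronglyMeasurable_slice',
            ae_restrict_mem measurableSet_Ioo] with t htm htI
          have hat : AEStronglyMeasurable (a t) volume := by
            have hinc : Continuous fun x : EuclideanSpace ℝ (Fin 3) => ((t, x) : ℝ × EuclideanSpace ℝ (Fin 3)) :=
              continuous_const.prodMk continuous_id
            exact (hacont.comp_continuous hinc fun x => ⟨hIS₂ htI, mem_univ x⟩).aestronglyMeasurable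
          have hm2 : AEMeasurable (fun x => ‖u t x - a t x‖ₑ ^ 2) volume := (htm.sub hat).enorm.pow_const _
          rw [lintegral_const_mul'' _ hm2]
      _ ≤ ∫⁻ t in I, ENNReal.ofReal (t ^ (-(1 / 2 : ℝ))) * (2 * (Eu + Ea)) := by
          refine lintegral_mono_ae ?_
          filter_upwards [hslice] with t ht
          exact mul_le_mul' le_rfl ht
      _ = (∫⁻ t in I, ENNReal.ofReal (t ^ (-(1 / 2 : ℝ)))) * (2 * (Eu + Ea)) := by
          rw [lintegral_mul_const' _ _ (ENNReal.mul_ne_top ENNReal.ofNat_ne_top (ENNReal.add_ne_top.2 ⟨hEu, hEa⟩))]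
      _ < ⊤ := by
          refine ENNReal.mul_lt_top ?_ (ENNReal.mul_lt_top ENNReal.ofNat_lt_top (ENNReal.add_lt_top.2 ⟨hEu.lt_top, hEa.lt_top⟩))
          have h := hrpowI.setLIntegral_lt_top
          exact h
  -- ## the a.e. set of times
  have hslice := ae_restrict_of_ae_restrict_of_subset hIT' hu.ae_aestronglyMeasurable_slice'
  have hu2S := ae_restrict_of_ae_restrict_of_subset hIT' hu2
  filter_upwards [hineq, ae_restrict_mem measurableSet_Ioo, hu2S, hslice] with s hIN hs hus2 husm
  have hs0 : 0 < s := hs.1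
  have hsS : s < S := hs.2
  have hsS₂ : s < S₂ := hsS.trans_le hSS₂
  -- the strip `(0,s) × ℝ³`
  set Is : Set ℝ := Ioo 0 s with hIs
  have hIsI : Is ⊆ I := Ioo_subset_Ioo_right hsS.le
  have hIsS₂ : Is ⊆ Ioo 0 S₂ := hIsI.trans hIS₂
  have hIsS₀ : Is ⊆ Ioo 0 S₀ := hIsI.trans hIS₀
  set μs : Measure (ℝ × EuclideanSpace ℝ (Fin 3)) := volume.restrict (Is ×ˢ (univ : Set (EuclideanSpace ℝ (Fin 3)))) with hμs
  have hμsI : μs ≤ μI := Measure.restrict_mono (Set.prod_mono hIsI Subset.rfl) le_rfl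
  have hIsm : MeasurableSet (Is ×ˢ (univ : Set (EuclideanSpace ℝ (Fin 3)))) := measurableSet_Ioo.prod MeasurableSet.univ
  have hmems : ∀ᵐ z ∂μs, z ∈ Is ×ˢ (univ : Set (EuclideanSpace ℝ (Fin 3))) := ae_restrict_mem hIsm
  -- ## the slices at `s`
  have has : AEStronglyMeasurable (a s) volume := by
    have hinc : Continuous fun x : EuclideanSpace ℝ (Fin 3) => ((s, x) : ℝ × EuclideanSpace ℝ (Fin 3)) :=
      continuous_const.prodMk continuous_id
    exact (hacont.comp_continuous hinc fun x => ⟨⟨hs0, hsS₂⟩, mem_univ x⟩).aestronglyMeasurable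
  have hws2 : ∫⁻ x, ‖u s x - a s x‖ₑ ^ 2 < ⊤ := by
    calc ∫⁻ x, ‖u s x - a s x‖ₑ ^ 2 ≤ ∫⁻ x, 2 * (‖u s x‖ₑ ^ 2 + ‖a s x‖ₑ ^ 2) := by
          refine lintegral_mono fun x => ?_
          calc ‖u s x - a s x‖ₑ ^ 2 ≤ (‖u s x‖ₑ + ‖a s x‖ₑ) ^ 2 := by gcongr; exact enorm_sub_le
            _ ≤ 2 * (‖u s x‖ₑ ^ 2 + ‖a s x‖ₑ ^ 2) := (ennreal_add_sq_le _ _).trans_eq (by ring)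
      _ = 2 * ((∫⁻ x, ‖u s x‖ₑ ^ 2) + ∫⁻ x, ‖a s x‖ₑ ^ 2) := by
          rw [lintegral_const_mul' _ _ ENNReal.ofNat_ne_top, lintegral_add_left' (husm.enorm.pow_const _)]
      _ < ⊤ := ENNReal.mul_lt_top ENNReal.ofNat_lt_top (ENNReal.add_lt_top.2
          ⟨hus2.trans_lt hEu.lt_top, (ha2 s ⟨hs0, hsS₂⟩).trans_lt hEa.lt_top⟩)
  have hwsInt : Integrable (fun x => ‖u s x - a s x‖ ^ 2) volume := by
    refine ⟨(husm.sub has).norm.pow 2, ?_⟩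
    show ∫⁻ x, ‖‖u s x - a s x‖ ^ 2‖ₑ < ⊤
    have e : ∀ x, ‖‖u s x - a s x‖ ^ 2‖ₑ = ‖u s x - a s x‖ₑ ^ 2 := fun x => by
      rw [Real.enorm_eq_ofReal (sq_nonneg _), ENNReal.ofReal_pow (norm_nonneg _), ofReal_norm]
    simp_rw [e]
    exact hws2
  have hw0Int : Integrable (fun x => ‖u₀ x - a₀ x‖ ^ 2) volume :=
    (memLp_two_iff_integrable_sq_norm (hu₀2.sub ha₀2).1).1 (hu₀2.sub ha₀2)
  -- ## (C3), (C4): the energies at time `s` and `0`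
  have hWlim : Tendsto (fun n => ∫ x, ‖u s x - a s x‖ ^ 2 * ψ n x) atTop (𝓝 (∫ x, ‖u s x - a s x‖ ^ 2)) := by
    have h := tendsto_integral_of_dominated_convergence (fun x => ‖u s x - a s x‖ ^ 2)
      (F := fun n x => ‖u s x - a s x‖ ^ 2 * ψ n x) (f := fun x => ‖u s x - a s x‖ ^ 2 * 1)
      (fun n => hwsInt.1.mul (hψcd n).continuous.aestronglyMeasurable) hwsInt
      (fun n => ae_of_all _ fun x => by
        rw [Real.norm_eq_abs, abs_of_nonneg (mul_nonneg (sq_nonneg _) (hψ0 n x))]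
        exact mul_le_of_le_one_right (sq_nonneg _) (hψ1 n x))
      (ae_of_all _ fun x => (hψlim x).const_mul (‖u s x - a s x‖ ^ 2))
    simpa only [mul_one] using h
  have hW0lim : Tendsto (fun n => ∫ x, ‖u₀ x - a₀ x‖ ^ 2 * ψ n x) atTop (𝓝 (∫ x, ‖u₀ x - a₀ x‖ ^ 2)) := by
    have h := tendsto_integral_of_dominated_convergence (fun x => ‖u₀ x - a₀ x‖ ^ 2)
      (F := fun n x => ‖u₀ x - a₀ x‖ ^ 2 * ψ n x) (f := fun x => ‖u₀ x - a₀ x‖ ^ 2 * 1)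
      (fun n => hw0Int.1.mul (hψcd n).continuous.aestronglyMeasurable) hw0Int
      (fun n => ae_of_all _ fun x => by
        rw [Real.norm_eq_abs, abs_of_nonneg (mul_nonneg (sq_nonneg _) (hψ0 n x))]
        exact mul_le_of_le_one_right (sq_nonneg _) (hψ1 n x))
      (ae_of_all _ fun x => (hψlim x).const_mul (‖u₀ x - a₀ x‖ ^ 2))
    simpa only [mul_one] using h
  -- ## (C1), (C2): the dissipation
  set Dfun : ℝ × EuclideanSpace ℝ (Fin 3) → ℝ≥0∞ := fun z =>
    ENNReal.ofReal (frobeniusNormSq (G z.1 z.2 - fderiv ℝ (a z.1) z.2)) with hDfun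
  have hDmono : Monotone (fun n : ℕ => Is ×ˢ ball (0 : EuclideanSpace ℝ (Fin 3)) ((n : ℝ) + 1)) := by
    intro m n hmn
    exact Set.prod_mono Subset.rfl (ball_subset_ball (by
      have h := (Nat.cast_le (α := ℝ)).mpr hmn
      linarith))
  have hDlim : Tendsto (fun n : ℕ => ∫⁻ z in Is ×ˢ ball (0 : EuclideanSpace ℝ (Fin 3)) ((n : ℝ) + 1), Dfun z)
      atTop (𝓝 (∫⁻ z in Is ×ˢ (univ : Set (EuclideanSpace ℝ (Fin 3))), Dfun z)) := by
    have hunion : (⋃ n : ℕ, Is ×ˢ ball (0 : EuclideanSpace ℝ (Fin 3)) ((n : ℝ) + 1)) =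
        Is ×ˢ (univ : Set (EuclideanSpace ℝ (Fin 3))) := by
      rw [← Set.prod_iUnion, iUnion_ball_nat_succ]
    rw [← hunion, setLIntegral_iUnion_of_directed _ hDmono.directed_le]
    exact tendsto_atTop_iSup fun m n hmn => lintegral_mono_set (hDmono hmn)
  have hD'le : ∀ n : ℕ, ∫⁻ z in Is ×ˢ ball (0 : EuclideanSpace ℝ (Fin 3)) ((n : ℝ) + 1), Dfun z ≤
      ∫⁻ z in Is ×ˢ (univ : Set (EuclideanSpace ℝ (Fin 3))),
        ENNReal.ofReal (frobeniusNormSq (G z.1 z.2 - fderiv ℝ (a z.1) z.2) * ψ n z.2) := by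
    intro n
    calc ∫⁻ z in Is ×ˢ ball (0 : EuclideanSpace ℝ (Fin 3)) ((n : ℝ) + 1), Dfun z
        = ∫⁻ z in Is ×ˢ ball (0 : EuclideanSpace ℝ (Fin 3)) ((n : ℝ) + 1),
            ENNReal.ofReal (frobeniusNormSq (G z.1 z.2 - fderiv ℝ (a z.1) z.2) * ψ n z.2) := by
          refine setLIntegral_congr_fun (measurableSet_Ioo.prod measurableSet_ball) fun z hz => ?_
          simp only [hDfun]
          rw [hψone n z.2 (le_of_lt (mem_ball_zero_iff.1 hz.2)), mul_one]
      _ ≤ _ := lintegral_mono_set (Set.prod_mono Subset.rfl (subset_univ _))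
  -- ## (C5): the fluxes
  set w : ℝ × EuclideanSpace ℝ (Fin 3) → EuclideanSpace ℝ (Fin 3) := fun z => u z.1 z.2 - a z.1 z.2 with hw
  have hwms : AEStronglyMeasurable w μs := hwm.mono_measure hμsI
  have hums : AEStronglyMeasurable (uncurry u) μs := hum.mono_measure hμsI
  have hpms : AEStronglyMeasurable (uncurry p) μs := hpm.mono_measure hμsI
  have hpKms : AEStronglyMeasurable (uncurry pK) μs := hpKm.mono_measure hμsI
  have hDams : AEStronglyMeasurable (fun z : ℝ × (EuclideanSpace ℝ (Fin 3)) => fderiv ℝ (a z.1) z.2) μs :=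
    hDam.mono_measure hμsI
  -- integrable dominating functions on the strip `(0,s) × ℝ³`
  have hint_w2 : Integrable (fun z => ‖w z‖ ^ 2) μs := by
    refine ⟨hwms.norm.pow 2, ?_⟩
    show ∫⁻ z, ‖‖w z‖ ^ 2‖ₑ ∂μs < ⊤
    have e : ∀ z, ‖‖w z‖ ^ 2‖ₑ = ‖w z‖ₑ ^ 2 := fun z => by
      rw [Real.enorm_eq_ofReal (sq_nonneg _), ENNReal.ofReal_pow (norm_nonneg _), ofReal_norm]
    simp_rw [e]
    exact (lintegral_mono' hμsI le_rfl).trans_lt hw2It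
  have hint_w3 : Integrable (fun z => ‖w z‖ ^ 3) μs := by
    refine ⟨hwms.norm.pow 3, ?_⟩
    show ∫⁻ z, ‖‖w z‖ ^ 3‖ₑ ∂μs < ⊤
    have e : ∀ z, ‖‖w z‖ ^ 3‖ₑ = ‖w z‖ₑ ^ (3 : ℕ) := fun z => by
      rw [Real.enorm_eq_ofReal (pow_nonneg (norm_nonneg _) _), ENNReal.ofReal_pow (norm_nonneg _), ofReal_norm]
    simp_rw [e]
    exact (lintegral_mono' hμsI le_rfl).trans_lt hw3I
  have hint_u3 : Integrable (fun z : ℝ × EuclideanSpace ℝ (Fin 3) => ‖u z.1 z.2‖ ^ 3) μs := by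
    refine ⟨hums.norm.pow 3, ?_⟩
    show ∫⁻ z, ‖‖u z.1 z.2‖ ^ 3‖ₑ ∂μs < ⊤
    have e : ∀ z : ℝ × EuclideanSpace ℝ (Fin 3), ‖‖u z.1 z.2‖ ^ 3‖ₑ = ‖u z.1 z.2‖ₑ ^ (3 : ℕ) := fun z => by
      rw [Real.enorm_eq_ofReal (pow_nonneg (norm_nonneg _) _), ENNReal.ofReal_pow (norm_nonneg _), ofReal_norm]
    simp_rw [e]
    exact (lintegral_mono' hμsI le_rfl).trans_lt hu3I
  have hint_p32 : Integrable (fun z : ℝ × EuclideanSpace ℝ (Fin 3) => |p z.1 z.2 - pK z.1 z.2| ^ (3 / 2 : ℝ)) μs := by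
    refine ⟨(((hpms.sub hpKms).norm.aemeasurable.pow_const (3 / 2 : ℝ)).aestronglyMeasurable).congr
      (Eventually.of_forall fun z => by simp only [Real.norm_eq_abs]; rfl), ?_⟩
    show ∫⁻ z, ‖|p z.1 z.2 - pK z.1 z.2| ^ (3 / 2 : ℝ)‖ₑ ∂μs < ⊤
    have e : ∀ z : ℝ × EuclideanSpace ℝ (Fin 3), ‖|p z.1 z.2 - pK z.1 z.2| ^ (3 / 2 : ℝ)‖ₑ =
        ‖p z.1 z.2 - pK z.1 z.2‖ₑ ^ (3 / 2 : ℝ) := fun z => by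
      rw [Real.enorm_eq_ofReal (Real.rpow_nonneg (abs_nonneg _) _), ← Real.norm_eq_abs,
        ← ENNReal.ofReal_rpow_of_nonneg (norm_nonneg _) (by norm_num), ofReal_norm]
    simp_rw [e]
    exact (lintegral_mono' hμsI le_rfl).trans_lt hppK32I
  have hint_tw : Integrable (fun z : ℝ × EuclideanSpace ℝ (Fin 3) => z.1 ^ (-(1 / 2 : ℝ)) * ‖w z‖ ^ 2) μs := by
    have hm : AEStronglyMeasurable (fun z : ℝ × EuclideanSpace ℝ (Fin 3) => z.1 ^ (-(1 / 2 : ℝ)) * ‖w z‖ ^ 2) μs :=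
      ((measurable_fst.pow_const _).aestronglyMeasurable).mul (hwms.norm.pow 2)
    refine ⟨hm, ?_⟩
    show ∫⁻ z, ‖z.1 ^ (-(1 / 2 : ℝ)) * ‖w z‖ ^ 2‖ₑ ∂μs < ⊤
    have e : ∀ᵐ z ∂μs, ‖z.1 ^ (-(1 / 2 : ℝ)) * ‖w z‖ ^ 2‖ₑ =
        ENNReal.ofReal (z.1 ^ (-(1 / 2 : ℝ))) * ‖w z‖ₑ ^ 2 := by
      filter_upwards [hmems] with z hz
      have ht0 : 0 ≤ z.1 ^ (-(1 / 2 : ℝ)) := Real.rpow_nonneg hz.1.1.le _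
      rw [enorm_mul, Real.enorm_eq_ofReal ht0, Real.enorm_eq_ofReal (sq_nonneg _),
        ENNReal.ofReal_pow (norm_nonneg _), ofReal_norm]
    rw [lintegral_congr_ae e]
    exact (lintegral_mono' hμsI le_rfl).trans_lt htw2I
  -- Young: `b² c ≤ (2/3) b³ + (1/3) c³`
  have hyoung : ∀ b c : ℝ, 0 ≤ b → 0 ≤ c → b ^ 2 * c ≤ (2 / 3) * b ^ 3 + (1 / 3) * c ^ 3 := by
    intro b c hb hc
    nlinarith [mul_nonneg (sq_nonneg (b - c)) (by positivity : (0 : ℝ) ≤ 2 * b + c)]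
  have hint_w2u : Integrable (fun z : ℝ × EuclideanSpace ℝ (Fin 3) => ‖w z‖ ^ 2 * ‖u z.1 z.2‖) μs := by
    refine ((hint_w3.const_mul (2 / 3)).add (hint_u3.const_mul (1 / 3))).mono'
      ((hwms.norm.pow 2).mul hums.norm) (Eventually.of_forall fun z => ?_)
    rw [Real.norm_eq_abs, abs_of_nonneg (by positivity)]
    exact hyoung _ _ (norm_nonneg _) (norm_nonneg _)
  have hint_pw : Integrable (fun z : ℝ × EuclideanSpace ℝ (Fin 3) => |p z.1 z.2 - pK z.1 z.2| * ‖w z‖) μs := by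
    refine ((hint_p32.const_mul (2 / 3)).add (hint_w3.const_mul (1 / 3))).mono'
      ((hpms.sub hpKms).norm.mul hwms.norm |>.congr (Eventually.of_forall fun z => by
        simp only [Real.norm_eq_abs, Pi.sub_apply]; rfl)) (Eventually.of_forall fun z => ?_)
    rw [Real.norm_eq_abs, abs_of_nonneg (by positivity)]
    have h := mul_le_rpow_threeHalves_add_cube (|p z.1 z.2 - pK z.1 z.2|) (norm_nonneg (w z))
    rwa [abs_abs] at h
  have hDa_le : ∀ z ∈ Is ×ˢ (univ : Set (EuclideanSpace ℝ (Fin 3))),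
      ‖fderiv ℝ (a z.1) z.2‖ ≤ C₁ * A * z.1 ^ (-(1 / 2 : ℝ)) := by
    intro z hz
    have ht : 0 < z.1 := hz.1.1
    have h := hgrad z.1 (hIsS₀ hz.1) z.2
    have hsq : 0 < Real.sqrt z.1 := Real.sqrt_pos.2 ht
    rw [Real.rpow_neg ht.le, ← Real.sqrt_eq_rpow, ← div_eq_mul_inv, le_div_iff₀ hsq, mul_comm]
    exact h
  have hint_R4 : Integrable (fun z : ℝ × EuclideanSpace ℝ (Fin 3) => ⟪fderiv ℝ (a z.1) z.2 (w z), w z⟫) μs := by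
    have happ : AEStronglyMeasurable (fun z : ℝ × (EuclideanSpace ℝ (Fin 3)) => fderiv ℝ (a z.1) z.2 (w z)) μs :=
      isBoundedBilinearMap_apply.continuous.comp_aestronglyMeasurable (hDams.prodMk hwms)
    have hm : AEStronglyMeasurable (fun z : ℝ × EuclideanSpace ℝ (Fin 3) => ⟪fderiv ℝ (a z.1) z.2 (w z), w z⟫) μs :=
      happ.inner hwms
    refine (hint_tw.const_mul (C₁ * A)).mono' hm ?_
    filter_upwards [hmems] with z hz
    calc ‖⟪fderiv ℝ (a z.1) z.2 (w z), w z⟫‖ ≤ ‖fderiv ℝ (a z.1) z.2 (w z)‖ * ‖w z‖ := norm_inner_le_norm _ _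
      _ ≤ (‖fderiv ℝ (a z.1) z.2‖ * ‖w z‖) * ‖w z‖ := by gcongr; exact ContinuousLinearMap.le_opNorm _ _
      _ ≤ (C₁ * A * z.1 ^ (-(1 / 2 : ℝ)) * ‖w z‖) * ‖w z‖ := by gcongr; exact hDa_le z hz
      _ = C₁ * A * (z.1 ^ (-(1 / 2 : ℝ)) * ‖w z‖ ^ 2) := by ring
  -- the four flux integrands and their integrals
  have hf1 : ∀ n, Integrable (fun z : ℝ × EuclideanSpace ℝ (Fin 3) => ‖w z‖ ^ 2 * (Δ (ψ n)) z.2) μs := fun n => by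
    have hLm : AEStronglyMeasurable (fun z : ℝ × EuclideanSpace ℝ (Fin 3) => (Δ (ψ n)) z.2) μs :=
      ((hLcont n).comp continuous_snd).aestronglyMeasurable
    refine (hint_w2.mul_const (CL / ((n : ℝ) + 1) ^ 2)).mono' ((hwms.norm.pow 2).mul hLm) (Eventually.of_forall fun z => ?_)
    rw [norm_mul, Real.norm_eq_abs, Real.norm_eq_abs, abs_of_nonneg (sq_nonneg _)]
    exact mul_le_mul_of_nonneg_left (hLapψ n z.2) (sq_nonneg _)
  have hf2 : ∀ n, Integrable (fun z : ℝ × EuclideanSpace ℝ (Fin 3) => ‖w z‖ ^ 2 * ⟪u z.1 z.2, gradient (ψ n) z.2⟫) μs := fun n => by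
    have hgm : AEStronglyMeasurable (fun z : ℝ × EuclideanSpace ℝ (Fin 3) => gradient (ψ n) z.2) μs :=
      ((hgcont n).comp continuous_snd).aestronglyMeasurable
    refine (hint_w2u.mul_const (Cg / ((n : ℝ) + 1))).mono' ((hwms.norm.pow 2).mul (hums.inner hgm))
      (Eventually.of_forall fun z => ?_)
    rw [norm_mul, Real.norm_eq_abs, abs_of_nonneg (sq_nonneg _)]
    calc ‖w z‖ ^ 2 * ‖⟪u z.1 z.2, gradient (ψ n) z.2⟫‖ ≤ ‖w z‖ ^ 2 * (‖u z.1 z.2‖ * (Cg / ((n : ℝ) + 1))) := by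
          refine mul_le_mul_of_nonneg_left ((norm_inner_le_norm _ _).trans ?_) (sq_nonneg _)
          exact mul_le_mul_of_nonneg_left (hgradψ n z.2) (norm_nonneg _)
      _ = ‖w z‖ ^ 2 * ‖u z.1 z.2‖ * (Cg / ((n : ℝ) + 1)) := by ring
  have hf3 : ∀ n, Integrable (fun z : ℝ × EuclideanSpace ℝ (Fin 3) =>
      (p z.1 z.2 - pK z.1 z.2) * ⟪w z, gradient (ψ n) z.2⟫) μs := fun n => by
    have hgm : AEStronglyMeasurable (fun z : ℝ × EuclideanSpace ℝ (Fin 3) => gradient (ψ n) z.2) μs :=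
      ((hgcont n).comp continuous_snd).aestronglyMeasurable
    refine (hint_pw.mul_const (Cg / ((n : ℝ) + 1))).mono' ((hpms.sub hpKms).mul (hwms.inner hgm) |>.congr
      (Eventually.of_forall fun z => by rfl)) (Eventually.of_forall fun z => ?_)
    rw [norm_mul, Real.norm_eq_abs]
    calc |p z.1 z.2 - pK z.1 z.2| * ‖⟪w z, gradient (ψ n) z.2⟫‖
        ≤ |p z.1 z.2 - pK z.1 z.2| * (‖w z‖ * (Cg / ((n : ℝ) + 1))) := by
          refine mul_le_mul_of_nonneg_left ((norm_inner_le_norm _ _).trans ?_) (abs_nonneg _)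
          exact mul_le_mul_of_nonneg_left (hgradψ n z.2) (norm_nonneg _)
      _ = |p z.1 z.2 - pK z.1 z.2| * ‖w z‖ * (Cg / ((n : ℝ) + 1)) := by ring
  have hf4 : ∀ n, Integrable (fun z : ℝ × EuclideanSpace ℝ (Fin 3) =>
      ψ n z.2 * ⟪fderiv ℝ (a z.1) z.2 (w z), w z⟫) μs := fun n => by
    have hψm : AEStronglyMeasurable (fun z : ℝ × EuclideanSpace ℝ (Fin 3) => ψ n z.2) μs :=
      ((hψcd n).continuous.comp continuous_snd).aestronglyMeasurable
    refine hint_R4.norm.mono' (hψm.mul hint_R4.1) (Eventually.of_forall fun z => ?_)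
    rw [norm_mul, Real.norm_eq_abs]
    calc |ψ n z.2| * ‖⟪fderiv ℝ (a z.1) z.2 (w z), w z⟫‖ ≤ 1 * ‖⟪fderiv ℝ (a z.1) z.2 (w z), w z⟫‖ := by
          gcongr; exact hψabs n z.2
      _ = _ := one_mul _
  -- the limits of the four fluxes
  have hF1lim : Tendsto (fun n => ∫ z, ‖w z‖ ^ 2 * (Δ (ψ n)) z.2 ∂μs) atTop (𝓝 0) := by
    refine squeeze_zero_norm (fun n => ?_)
      (show Tendsto (fun n : ℕ => CL / ((n : ℝ) + 1) ^ 2 * ∫ z, ‖w z‖ ^ 2 ∂μs) atTop (𝓝 0) from ?_)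
    · calc ‖∫ z, ‖w z‖ ^ 2 * (Δ (ψ n)) z.2 ∂μs‖ ≤ ∫ z, ‖‖w z‖ ^ 2 * (Δ (ψ n)) z.2‖ ∂μs := norm_integral_le_integral_norm _
        _ ≤ ∫ z, ‖w z‖ ^ 2 * (CL / ((n : ℝ) + 1) ^ 2) ∂μs := by
            refine integral_mono_of_nonneg (Eventually.of_forall fun z => norm_nonneg _)
              (hint_w2.mul_const _) (Eventually.of_forall fun z => ?_)
            dsimp only
            rw [norm_mul, Real.norm_eq_abs, Real.norm_eq_abs, abs_of_nonneg (sq_nonneg _)]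
            exact mul_le_mul_of_nonneg_left (hLapψ n z.2) (sq_nonneg _)
        _ = CL / ((n : ℝ) + 1) ^ 2 * ∫ z, ‖w z‖ ^ 2 ∂μs := by rw [integral_mul_const, mul_comm]
    · have h1 : Tendsto (fun n : ℕ => CL / ((n : ℝ) + 1) ^ 2) atTop (𝓝 0) := by
        have h := (tendsto_natCast_atTop_atTop (R := ℝ)).atTop_add tendsto_const_nhds (C := (1 : ℝ))
        have h2 : Tendsto (fun n : ℕ => ((n : ℝ) + 1) ^ 2) atTop atTop :=
          (tendsto_pow_atTop two_ne_zero).comp h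
        exact tendsto_const_nhds.div_atTop h2
      simpa using h1.mul_const (∫ z, ‖w z‖ ^ 2 ∂μs)
  have hF2lim : Tendsto (fun n => ∫ z, ‖w z‖ ^ 2 * ⟪u z.1 z.2, gradient (ψ n) z.2⟫ ∂μs) atTop (𝓝 0) := by
    refine squeeze_zero_norm (fun n => ?_)
      (show Tendsto (fun n : ℕ => Cg / ((n : ℝ) + 1) * ∫ z, ‖w z‖ ^ 2 * ‖u z.1 z.2‖ ∂μs) atTop (𝓝 0) from ?_)
    · calc ‖∫ z, ‖w z‖ ^ 2 * ⟪u z.1 z.2, gradient (ψ n) z.2⟫ ∂μs‖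
          ≤ ∫ z, ‖‖w z‖ ^ 2 * ⟪u z.1 z.2, gradient (ψ n) z.2⟫‖ ∂μs := norm_integral_le_integral_norm _
        _ ≤ ∫ z, ‖w z‖ ^ 2 * ‖u z.1 z.2‖ * (Cg / ((n : ℝ) + 1)) ∂μs := by
            refine integral_mono_of_nonneg (Eventually.of_forall fun z => norm_nonneg _)
              (hint_w2u.mul_const _) (Eventually.of_forall fun z => ?_)
            dsimp only
            rw [norm_mul, Real.norm_eq_abs, abs_of_nonneg (sq_nonneg _)]
            calc ‖w z‖ ^ 2 * ‖⟪u z.1 z.2, gradient (ψ n) z.2⟫‖ ≤ ‖w z‖ ^ 2 * (‖u z.1 z.2‖ * (Cg / ((n : ℝ) + 1))) := by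
                  refine mul_le_mul_of_nonneg_left ((norm_inner_le_norm _ _).trans ?_) (sq_nonneg _)
                  exact mul_le_mul_of_nonneg_left (hgradψ n z.2) (norm_nonneg _)
              _ = ‖w z‖ ^ 2 * ‖u z.1 z.2‖ * (Cg / ((n : ℝ) + 1)) := by ring
        _ = Cg / ((n : ℝ) + 1) * ∫ z, ‖w z‖ ^ 2 * ‖u z.1 z.2‖ ∂μs := by rw [integral_mul_const, mul_comm]
    · have h1 : Tendsto (fun n : ℕ => Cg / ((n : ℝ) + 1)) atTop (𝓝 0) :=
        tendsto_const_nhds.div_atTop ((tendsto_natCast_atTop_atTop (R := ℝ)).atTop_add tendsto_const_nhds)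
      simpa using h1.mul_const (∫ z, ‖w z‖ ^ 2 * ‖u z.1 z.2‖ ∂μs)
  have hF3lim : Tendsto (fun n => ∫ z, (p z.1 z.2 - pK z.1 z.2) * ⟪w z, gradient (ψ n) z.2⟫ ∂μs) atTop (𝓝 0) := by
    refine squeeze_zero_norm (fun n => ?_)
      (show Tendsto (fun n : ℕ => Cg / ((n : ℝ) + 1) * ∫ z, |p z.1 z.2 - pK z.1 z.2| * ‖w z‖ ∂μs) atTop (𝓝 0) from ?_)
    · calc ‖∫ z, (p z.1 z.2 - pK z.1 z.2) * ⟪w z, gradient (ψ n) z.2⟫ ∂μs‖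
          ≤ ∫ z, ‖(p z.1 z.2 - pK z.1 z.2) * ⟪w z, gradient (ψ n) z.2⟫‖ ∂μs := norm_integral_le_integral_norm _
        _ ≤ ∫ z, |p z.1 z.2 - pK z.1 z.2| * ‖w z‖ * (Cg / ((n : ℝ) + 1)) ∂μs := by
            refine integral_mono_of_nonneg (Eventually.of_forall fun z => norm_nonneg _)
              (hint_pw.mul_const _) (Eventually.of_forall fun z => ?_)
            dsimp only
            rw [norm_mul, Real.norm_eq_abs]
            calc |p z.1 z.2 - pK z.1 z.2| * ‖⟪w z, gradient (ψ n) z.2⟫‖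
                ≤ |p z.1 z.2 - pK z.1 z.2| * (‖w z‖ * (Cg / ((n : ℝ) + 1))) := by
                  refine mul_le_mul_of_nonneg_left ((norm_inner_le_norm _ _).trans ?_) (abs_nonneg _)
                  exact mul_le_mul_of_nonneg_left (hgradψ n z.2) (norm_nonneg _)
              _ = |p z.1 z.2 - pK z.1 z.2| * ‖w z‖ * (Cg / ((n : ℝ) + 1)) := by ring
        _ = Cg / ((n : ℝ) + 1) * ∫ z, |p z.1 z.2 - pK z.1 z.2| * ‖w z‖ ∂μs := by rw [integral_mul_const, mul_comm]
    · have h1 : Tendsto (fun n : ℕ => Cg / ((n : ℝ) + 1)) atTop (𝓝 0) :=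
        tendsto_const_nhds.div_atTop ((tendsto_natCast_atTop_atTop (R := ℝ)).atTop_add tendsto_const_nhds)
      simpa using h1.mul_const (∫ z, |p z.1 z.2 - pK z.1 z.2| * ‖w z‖ ∂μs)
  have hF4lim : Tendsto (fun n => ∫ z, ψ n z.2 * ⟪fderiv ℝ (a z.1) z.2 (w z), w z⟫ ∂μs) atTop
      (𝓝 (∫ z, ⟪fderiv ℝ (a z.1) z.2 (w z), w z⟫ ∂μs)) := by
    have h := tendsto_integral_of_dominated_convergence (fun z => ‖⟪fderiv ℝ (a z.1) z.2 (w z), w z⟫‖)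
      (F := fun n z => ψ n z.2 * ⟪fderiv ℝ (a z.1) z.2 (w z), w z⟫)
      (f := fun z => 1 * ⟪fderiv ℝ (a z.1) z.2 (w z), w z⟫) (fun n => (hf4 n).1) hint_R4.norm
      (fun n => ae_of_all _ fun z => by
        rw [norm_mul, Real.norm_eq_abs]
        calc |ψ n z.2| * ‖⟪fderiv ℝ (a z.1) z.2 (w z), w z⟫‖ ≤ 1 * ‖⟪fderiv ℝ (a z.1) z.2 (w z), w z⟫‖ := by
              gcongr; exact hψabs n z.2
          _ = _ := one_mul _)
      (ae_of_all _ fun z => (hψlim z.2).mul_const _)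
    simpa only [one_mul] using h
  -- the total flux and its limit
  have hFsum : ∀ n, ∫ z, (‖u z.1 z.2 - a z.1 z.2‖ ^ 2 * (Δ (ψ n)) z.2 +
        ‖u z.1 z.2 - a z.1 z.2‖ ^ 2 * ⟪u z.1 z.2, gradient (ψ n) z.2⟫ +
        2 * ((p z.1 z.2 - pK z.1 z.2) * ⟪u z.1 z.2 - a z.1 z.2, gradient (ψ n) z.2⟫) -
        2 * (ψ n z.2 * ⟪fderiv ℝ (a z.1) z.2 (u z.1 z.2 - a z.1 z.2), u z.1 z.2 - a z.1 z.2⟫)) ∂μs =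
      (∫ z, ‖w z‖ ^ 2 * (Δ (ψ n)) z.2 ∂μs) + (∫ z, ‖w z‖ ^ 2 * ⟪u z.1 z.2, gradient (ψ n) z.2⟫ ∂μs) +
        2 * (∫ z, (p z.1 z.2 - pK z.1 z.2) * ⟪w z, gradient (ψ n) z.2⟫ ∂μs) -
        2 * ∫ z, ψ n z.2 * ⟪fderiv ℝ (a z.1) z.2 (w z), w z⟫ ∂μs := by
    intro n
    have j12 : Integrable (fun z : ℝ × EuclideanSpace ℝ (Fin 3) =>
        ‖w z‖ ^ 2 * (Δ (ψ n)) z.2 + ‖w z‖ ^ 2 * ⟪u z.1 z.2, gradient (ψ n) z.2⟫) μs := (hf1 n).add (hf2 n)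
    have j3 : Integrable (fun z : ℝ × EuclideanSpace ℝ (Fin 3) =>
        2 * ((p z.1 z.2 - pK z.1 z.2) * ⟪w z, gradient (ψ n) z.2⟫)) μs := (hf3 n).const_mul 2
    have j4 : Integrable (fun z : ℝ × EuclideanSpace ℝ (Fin 3) =>
        2 * (ψ n z.2 * ⟪fderiv ℝ (a z.1) z.2 (w z), w z⟫)) μs := (hf4 n).const_mul 2
    have j123 : Integrable (fun z : ℝ × EuclideanSpace ℝ (Fin 3) =>
        ‖w z‖ ^ 2 * (Δ (ψ n)) z.2 + ‖w z‖ ^ 2 * ⟪u z.1 z.2, gradient (ψ n) z.2⟫ +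
        2 * ((p z.1 z.2 - pK z.1 z.2) * ⟪w z, gradient (ψ n) z.2⟫)) μs := j12.add j3
    show ∫ z, ((‖w z‖ ^ 2 * (Δ (ψ n)) z.2 + ‖w z‖ ^ 2 * ⟪u z.1 z.2, gradient (ψ n) z.2⟫ +
        2 * ((p z.1 z.2 - pK z.1 z.2) * ⟪w z, gradient (ψ n) z.2⟫)) -
        2 * (ψ n z.2 * ⟪fderiv ℝ (a z.1) z.2 (w z), w z⟫)) ∂μs = _
    rw [integral_sub j123 j4, integral_add j12 j3, integral_add (hf1 n) (hf2 n), integral_const_mul,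
      integral_const_mul]
  have hFlim : Tendsto (fun n => ∫ z, (‖u z.1 z.2 - a z.1 z.2‖ ^ 2 * (Δ (ψ n)) z.2 +
        ‖u z.1 z.2 - a z.1 z.2‖ ^ 2 * ⟪u z.1 z.2, gradient (ψ n) z.2⟫ +
        2 * ((p z.1 z.2 - pK z.1 z.2) * ⟪u z.1 z.2 - a z.1 z.2, gradient (ψ n) z.2⟫) -
        2 * (ψ n z.2 * ⟪fderiv ℝ (a z.1) z.2 (u z.1 z.2 - a z.1 z.2), u z.1 z.2 - a z.1 z.2⟫)) ∂μs) atTop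
      (𝓝 (-2 * ∫ z, ⟪fderiv ℝ (a z.1) z.2 (u z.1 z.2 - a z.1 z.2), u z.1 z.2 - a z.1 z.2⟫ ∂μs)) := by
    have h := ((hF1lim.add hF2lim).add (hF3lim.const_mul 2)).sub (hF4lim.const_mul 2)
    have e : (0 : ℝ) + 0 + 2 * 0 - 2 * (∫ z, ⟪fderiv ℝ (a z.1) z.2 (w z), w z⟫ ∂μs) =
        -2 * ∫ z, ⟪fderiv ℝ (a z.1) z.2 (u z.1 z.2 - a z.1 z.2), u z.1 z.2 - a z.1 z.2⟫ ∂μs := by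
      simp only [hw]; ring
    rw [e] at h
    exact h.congr fun n => (hFsum n).symm
  -- ## (C6): passage to the limit in the sliced inequalities
  have hLHS : Tendsto (fun n : ℕ => ENNReal.ofReal (∫ x, ‖u s x - a s x‖ ^ 2 * ψ n x) +
      2 * ∫⁻ z in Is ×ˢ ball (0 : EuclideanSpace ℝ (Fin 3)) ((n : ℝ) + 1), Dfun z) atTop
      (𝓝 (ENNReal.ofReal (∫ x, ‖u s x - a s x‖ ^ 2) + 2 * ∫⁻ z in Is ×ˢ (univ : Set (EuclideanSpace ℝ (Fin 3))), Dfun z)) :=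
    (ENNReal.tendsto_ofReal hWlim).add (ENNReal.Tendsto.const_mul hDlim (Or.inr ENNReal.ofNat_ne_top))
  have hRHS : Tendsto (fun n : ℕ => ENNReal.ofReal (∫ x, ‖u₀ x - a₀ x‖ ^ 2 * ψ n x) +
      ENNReal.ofReal (∫ z, (‖u z.1 z.2 - a z.1 z.2‖ ^ 2 * (Δ (ψ n)) z.2 +
        ‖u z.1 z.2 - a z.1 z.2‖ ^ 2 * ⟪u z.1 z.2, gradient (ψ n) z.2⟫ +
        2 * ((p z.1 z.2 - pK z.1 z.2) * ⟪u z.1 z.2 - a z.1 z.2, gradient (ψ n) z.2⟫) -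
        2 * (ψ n z.2 * ⟪fderiv ℝ (a z.1) z.2 (u z.1 z.2 - a z.1 z.2), u z.1 z.2 - a z.1 z.2⟫)) ∂μs)) atTop
      (𝓝 (ENNReal.ofReal (∫ x, ‖u₀ x - a₀ x‖ ^ 2) +
        ENNReal.ofReal (-2 * ∫ z, ⟪fderiv ℝ (a z.1) z.2 (u z.1 z.2 - a z.1 z.2), u z.1 z.2 - a z.1 z.2⟫ ∂μs))) :=
    (ENNReal.tendsto_ofReal hW0lim).add (ENNReal.tendsto_ofReal hFlim)
  refine le_of_tendsto_of_tendsto' hLHS hRHS fun n => ?_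
  calc ENNReal.ofReal (∫ x, ‖u s x - a s x‖ ^ 2 * ψ n x) +
        2 * ∫⁻ z in Is ×ˢ ball (0 : EuclideanSpace ℝ (Fin 3)) ((n : ℝ) + 1), Dfun z
      ≤ ENNReal.ofReal (∫ x, ‖u s x - a s x‖ ^ 2 * ψ n x) +
        2 * ∫⁻ z in Is ×ˢ (univ : Set (EuclideanSpace ℝ (Fin 3))),
          ENNReal.ofReal (frobeniusNormSq (G z.1 z.2 - fderiv ℝ (a z.1) z.2) * ψ n z.2) :=
        add_le_add le_rfl (mul_le_mul' le_rfl (hD'le n))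
    _ ≤ _ := hIN n

/-! ### The Gronwall bound -/

/-- AM–GM in `ℝ≥0∞`: `X^{1/2} Y^{1/2} ≤ X/4 + Y`. [folklore] -/
theorem ennreal_sqrt_mul_sqrt_le (X Y : ℝ≥0∞) : X ^ (1 / 2 : ℝ) * Y ^ (1 / 2 : ℝ) ≤ X / 4 + Y := by
  rcases eq_or_ne X ⊤ with rfl | hX
  · by_cases hY : Y = 0
    · simp [hY, ENNReal.zero_rpow_of_pos]
    · rw [ENNReal.top_rpow_of_pos (by norm_num), ENNReal.top_div_of_ne_top (by norm_num), top_add]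
      exact le_top
  rcases eq_or_ne Y ⊤ with rfl | hY
  · rw [ENNReal.top_rpow_of_pos (by norm_num), add_top]; exact le_top
  lift X to ℝ≥0 using hX
  lift Y to ℝ≥0 using hY
  have e4 : ((X : ℝ≥0∞) / 4) = ((X / 4 : ℝ≥0) : ℝ≥0∞) := by
    rw [ENNReal.coe_div (by norm_num)]; norm_num
  rw [← ENNReal.coe_rpow_of_nonneg _ (by norm_num), ← ENNReal.coe_rpow_of_nonneg _ (by norm_num),
    ← ENNReal.coe_mul, e4, ← ENNReal.coe_add, ENNReal.coe_le_coe, ← NNReal.coe_le_coe]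
  push_cast
  rw [← Real.sqrt_eq_rpow, ← Real.sqrt_eq_rpow]
  have hx : (0 : ℝ) ≤ X := X.2
  have hy : (0 : ℝ) ≤ Y := Y.2
  nlinarith [sq_nonneg (Real.sqrt X / 2 - Real.sqrt Y), Real.sq_sqrt hx, Real.sq_sqrt hy,
    Real.sqrt_nonneg (X : ℝ), Real.sqrt_nonneg (Y : ℝ)]

/-- A property holding a.e. on `(0, T)` holds somewhere in every subinterval. [folklore] -/
private theorem exists_mem_Ioo_of_ae_restrict_slab {T a b : ℝ} {P : ℝ → Prop} (ha : 0 ≤ a) (hab : a < b)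
    (hbT : b ≤ T) (h : ∀ᵐ t ∂(volume.restrict (Ioo 0 T)), P t) : ∃ t ∈ Ioo a b, P t := by
  have hsub : Ioo a b ⊆ Ioo 0 T := fun t ht => ⟨ha.trans_lt ht.1, ht.2.trans_le hbT⟩
  have h' : ∀ᵐ t ∂(volume.restrict (Ioo a b)), P t := ae_restrict_of_ae_restrict_of_subset hsub h
  by_contra hne
  push Not at hne
  have hfalse : ∀ᵐ t ∂(volume.restrict (Ioo a b)), False := by
    filter_upwards [h', ae_restrict_mem measurableSet_Ioo] with t ht ht'
    exact hne t ht' ht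
  rw [eventually_false_iff_eq_bot, ae_eq_bot, Measure.restrict_eq_zero, Real.volume_Ioo] at hfalse
  exact absurd hfalse (ENNReal.ofReal_pos.2 (by linarith)).ne'

/-- **Continuity from below of the strip integral along a.e. times**: if
`∫∫_{(0,s)×ℝ³} f ≤ K` for a.e. `s ∈ (0,S)` then `∫∫_{(0,S)×ℝ³} f ≤ K`. [folklore] -/
theorem lintegral_strip_le_of_ae_le {S : ℝ} (hS : 0 < S) {f : ℝ × EuclideanSpace ℝ (Fin 3) → ℝ≥0∞} {K : ℝ≥0∞}
    (h : ∀ᵐ s ∂(volume.restrict (Ioo 0 S)),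
      ∫⁻ z in Ioo 0 s ×ˢ (univ : Set (EuclideanSpace ℝ (Fin 3))), f z ≤ K) :
    ∫⁻ z in Ioo 0 S ×ˢ (univ : Set (EuclideanSpace ℝ (Fin 3))), f z ≤ K := by
  -- an increasing sequence of times `s_n = S - S/(n+2) ↑ S`
  set sq : ℕ → ℝ := fun n => S - S / ((n : ℝ) + 2) with hsq
  have hsq_lt : ∀ n, sq n < S := fun n => by
    have : 0 < S / ((n : ℝ) + 2) := by positivity
    simp only [hsq]; linarith
  have hsq_pos : ∀ n, 0 < sq n := fun n => by
    simp only [hsq]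
    have h2 : S / ((n : ℝ) + 2) ≤ S / 2 := div_le_div_of_nonneg_left hS.le (by norm_num) (by linarith [n.cast_nonneg (α := ℝ)])
    linarith
  have hmono : Monotone fun n : ℕ => Ioo (0 : ℝ) (sq n) ×ˢ (univ : Set (EuclideanSpace ℝ (Fin 3))) := by
    intro m n hmn
    refine Set.prod_mono (Ioo_subset_Ioo_right ?_) Subset.rfl
    simp only [hsq]
    have : S / ((n : ℝ) + 2) ≤ S / ((m : ℝ) + 2) :=
      div_le_div_of_nonneg_left hS.le (by positivity) (by have := (Nat.cast_le (α := ℝ)).mpr hmn; linarith)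
    linarith
  have hunion : (⋃ n : ℕ, Ioo (0 : ℝ) (sq n) ×ˢ (univ : Set (EuclideanSpace ℝ (Fin 3)))) =
      Ioo 0 S ×ˢ (univ : Set (EuclideanSpace ℝ (Fin 3))) := by
    rw [← Set.iUnion_prod_const]
    congr 1
    refine Subset.antisymm (iUnion_subset fun n => Ioo_subset_Ioo_right (hsq_lt n).le) fun t ht => ?_
    rw [mem_iUnion]
    -- `S - t > S/(n+2)` for large `n`
    obtain ⟨n, hn⟩ := exists_nat_gt (S / (S - t))
    refine ⟨n, ht.1, ?_⟩
    simp only [hsq]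
    have hSt : 0 < S - t := by linarith [ht.2]
    have h1 : S / (S - t) < (n : ℝ) + 2 := by linarith
    have h2 : S / ((n : ℝ) + 2) < S - t := by
      rw [div_lt_iff₀ (by positivity)]
      rw [div_lt_iff₀ hSt] at h1
      nlinarith
    linarith
  rw [← hunion, setLIntegral_iUnion_of_directed _ hmono.directed_le]
  refine iSup_le fun n => ?_
  -- a good time in `(sq n, S)`
  obtain ⟨s, hs, hsK⟩ := exists_mem_Ioo_of_ae_restrict_slab (hsq_pos n).le (hsq_lt n) le_rfl h
  exact (lintegral_mono_set (Set.prod_mono (Ioo_subset_Ioo_right hs.1.le) Subset.rfl)).trans hsK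

end Literature.Analysis.FluidPDE
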